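import Literature.IUT.HodgeTheaters.InitialThetaDataTorsionProofs
import Mathlib.FieldTheory.PrimitiveElement
import Mathlib.FieldTheory.Finite.Basic
import HarnessLib

/-!
# [IUTchI] Def. 3.1 (c) ⇒ `[K : F] ≥ |SL₂(𝔽_l)| = (l−1)·l·(l+1)`: the degree floor of the `l`-division
# field of an initial Θ-datum (Dupuy–Hilado's "`d ≥ SL₂(𝔽_l) ≥ 6840`")

PROOF-ONLY companion of `InitialThetaData` / `InitialThetaDataTorsionProofs` (S. Mochizuki, *Inter-universal
Teichmüller theory I*, [IUTchI] Def. 3.1 (c), p. 62: "`l ≥ 5` … the image of the outer homomorphism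
`G_F → GL₂(𝔽_l)` determined by the `l`-torsion points of `E_F` contains the subgroup `SL₂(𝔽_l)`"; "`K ⊆ F̄`
… the finite Galois extension of `F` determined by the kernel of this homomorphism"), typed in the tree
as `ImageContainsSL2` (an `𝔽_l`-basis `(P, Q)` of `E_F[l](F̄)` on which every determinant-one integer
matrix is a Galois element) and `range_K_iff`. No new definition, no new `Prop` fact. Cited BY NAME:
`InitialThetaData.imageContainsSL2`, `galoisAct`, `galoisSubgroupOf`,
`InitialThetaData.galoisAct_eq_of_torsion_l` (`G_K` fixes `E_F[l](F̄)`), Mathlib `AlgHom.card`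
(`#(K →ₐ[F] F̄) = [K:F]`), `ZMod.card_units`, `ZMod.card`.

## What is PROVED

* `InitialThetaData.galoisAct_eq_of_forall_algebraMap_eq` — two elements of `G_F` that agree on `K`
  act identically on `E_F[l](F̄)`;
* `InitialThetaData.sl2_card_le_finrank` — **`(l−1)·l·(l+1) ≤ [K:F]`**: the `(l−1)l² + (l−1)l =
  |SL₂(𝔽_l)|` matrices `(u b; c u⁻¹(1+bc))`, `(0 u; −u⁻¹ d)` (`u ∈ 𝔽_lˣ`) are realised by Galois
  elements with pairwise distinct restrictions `K → F̄` (coefficients on the basis are recovered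
  mod `l`), and `#(K →ₐ[F] F̄) = [K:F]`;
* `InitialThetaData.sl2_card_le_finrank_rat` — `(l−1)·l·(l+1) ≤ [K:ℚ]`;
* `InitialThetaData.le_finrank_rat_of_nineteen_le` — **`l ≥ 19 ⇒ 6840 ≤ [K:ℚ]`**, the floor
  "Since `D, d ≥ SL₂(𝔽_l) ≥ 6840`" of Dupuy–Hilado arXiv:2004.13108v2 Thm 7.13.1 (p.29 l.27), whose
  `6840 = |SL₂(𝔽_19)|` presumes `l ≥ 19` (consumer: `Literature.IUT.LogVolume.DHBabySzpiroDegreeFloor`).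

HONEST FRAMING: elementary Galois theory of the typed Def. 3.1 (c); nothing here bears on [IUTchIII]
Cor. 3.12 [claim: Mochizuki2012, status: disputed]. Typed ≠ proved ≠ endorsed; no abc claim.
-/

noncomputable section

open scoped WeierstrassCurve.Affine Classical

namespace Literature.IUT.HodgeTheaters

open WeierstrassCurve

universe u v w

section Global

variable {F : Type u} {K : Type v} {Fbar : Type w} [Field F] [NumberField F] [Field K]
  [NumberField K] [Algebra F K] [Field Fbar] [Algebra F Fbar] [Algebra K Fbar]
  {E : WeierstrassCurve F} [E.IsElliptic] {l : ℕ} {Pb : BadPlacePredicates K}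
  (D : InitialThetaData F K Fbar E l Pb)

omit [NumberField F] [E.IsElliptic] in
/-- The Galois action on `E_F(F̄)` is multiplicative: `(στ)·P = σ·(τ·P)` (plumbing). [folklore] -/
private theorem galoisAct_mul_apply (σ τ : Fbar ≃ₐ[F] Fbar) (P : GeomPoints Fbar E) :
    galoisAct E (σ * τ) P = galoisAct E σ (galoisAct E τ P) := by
  cases P <;> rfl

namespace InitialThetaData

include D

/-- **Elements of `G_F` that agree on `K` act identically on `E_F[l](F̄)`** (`τ⁻¹σ ∈ G_K` fixes the
`l`-torsion, `galoisAct_eq_of_torsion_l`): the action of `G_F` on `E_F[l]` factors through `Gal(K/F)`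
(Def. 3.1 (c) "determined by the kernel"). [claim: Mochizuki2012, status: disputed]
[cite: Mochizuki2012, IUTchI Def. 3.1 (c) p. 62] -/
theorem galoisAct_eq_of_forall_algebraMap_eq {σ τ : Fbar ≃ₐ[F] Fbar}
    (h : ∀ z : K, σ (algebraMap K Fbar z) = τ (algebraMap K Fbar z))
    {Q : GeomPoints Fbar E} (hQ : (l : ℤ) • Q = 0) : galoisAct E σ Q = galoisAct E τ Q := by
  have hρ : τ⁻¹ * σ ∈ galoisSubgroupOf F K Fbar := fun z => by
    show τ.symm (σ (algebraMap K Fbar z)) = algebraMap K Fbar z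
    rw [h z]
    exact τ.symm_apply_apply _
  have h1 := D.galoisAct_eq_of_torsion_l hρ hQ
  have h2 : galoisAct E τ (galoisAct E (τ⁻¹ * σ) Q) = galoisAct E σ Q := by
    rw [← galoisAct_mul_apply, ← mul_assoc, mul_inv_cancel, one_mul]
  rw [h1] at h2
  exact h2.symm

/-- **`|SL₂(𝔽_l)| = (l−1)·l·(l+1) ≤ [K : F]`** for the `l`-division field `K` of an initial Θ-datum
([IUTchI] Def. 3.1 (c): the image of `G_F → GL₂(𝔽_l)` contains `SL₂(𝔽_l)` and `K` is cut out by its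
kernel, so `Gal(K/F)` surjects onto a group containing `SL₂(𝔽_l)`). Proof: the matrices
`(u b; c u⁻¹(1+bc))` and `(0 u; −u⁻¹ d)`, `u ∈ 𝔽_lˣ`, `b c d ∈ 𝔽_l` — all of `SL₂(𝔽_l)` — are realised
by `σ ∈ G_F` (`ImageContainsSL2`) whose restrictions `K → F̄` are pairwise distinct
(`galoisAct_eq_of_forall_algebraMap_eq` + independence of the basis), and `#(K →ₐ[F] F̄) = [K:F]`.
[claim: Mochizuki2012, status: disputed] [cite: Mochizuki2012, IUTchI Def. 3.1 (c) p. 62] -/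
theorem sl2_card_le_finrank : (l - 1) * l * (l + 1) ≤ Module.finrank F K := by
  classical
  haveI := D.isAlgClosure
  haveI := D.isScalarTower
  haveI : IsAlgClosed Fbar := IsAlgClosure.isAlgClosed F
  haveI : Fact l.Prime := ⟨D.l_prime⟩
  haveI : NeZero l := ⟨D.l_prime.ne_zero⟩
  haveI : FiniteDimensional F K := Module.Finite.of_restrictScalars_finite ℚ F K
  obtain ⟨P, Q, hP, hQ, hind, -, hreal⟩ := D.imageContainsSL2.exists_basis
  -- a Galois element for every `(a b; c d) ∈ SL₂(𝔽_l)`, coefficients lifted by `ZMod.val`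
  have hgal : ∀ a b c d : ZMod l, a * d - b * c = 1 → ∃ σ : Fbar ≃ₐ[F] Fbar,
      galoisAct E σ P = (a.val : ℤ) • P + (c.val : ℤ) • Q ∧
        galoisAct E σ Q = (b.val : ℤ) • P + (d.val : ℤ) • Q := by
    intro a b c d h
    apply hreal
    rw [← ZMod.intCast_zmod_eq_zero_iff_dvd]
    push_cast
    rw [ZMod.natCast_zmod_val, ZMod.natCast_zmod_val, ZMod.natCast_zmod_val, ZMod.natCast_zmod_val, h,
      sub_self]
  -- the coefficients on the basis are recovered mod `l`
  have hrec : ∀ a c a' c' : ZMod l, (a.val : ℤ) • P + (c.val : ℤ) • Q = (a'.val : ℤ) • P + (c'.val : ℤ) • Q →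
      a = a' ∧ c = c' := by
    intro a c a' c' h
    have h0 : ((a.val : ℤ) - a'.val) • P + ((c.val : ℤ) - c'.val) • Q = 0 := by
      have := sub_eq_zero.mpr h
      rw [sub_smul, sub_smul, ← this]
      abel
    obtain ⟨ha, hc⟩ := hind _ _ h0
    have key : ∀ x x' : ZMod l, (l : ℤ) ∣ (x.val : ℤ) - x'.val → x = x' := by
      intro x x' hx
      have h1 := (ZMod.intCast_eq_intCast_iff_dvd_sub (x'.val : ℤ) (x.val : ℤ) l).mpr hx
      simpa [ZMod.natCast_zmod_val] using h1.symm
    exact ⟨key a a' ha, key c c' hc⟩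
  -- the parametrisation of `SL₂(𝔽_l)`
  let ι := ((ZMod l)ˣ × ZMod l × ZMod l) ⊕ ((ZMod l)ˣ × ZMod l)
  let ent : ι → ZMod l × ZMod l × ZMod l × ZMod l := fun i =>
    match i with
    | Sum.inl ⟨u, b, c⟩ => ((u : ZMod l), b, c, ((u⁻¹ : (ZMod l)ˣ) : ZMod l) * (1 + b * c))
    | Sum.inr ⟨u, d⟩ => (0, (u : ZMod l), -((u⁻¹ : (ZMod l)ˣ) : ZMod l), d)
  have hdet : ∀ i, (ent i).1 * (ent i).2.2.2 - (ent i).2.1 * (ent i).2.2.1 = 1 := by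
    rintro (⟨u, b, c⟩ | ⟨u, d⟩)
    · simp only [ent]
      rw [Units.mul_inv_cancel_left]
      ring
    · simp only [ent]
      rw [zero_mul, mul_neg, zero_sub, neg_neg, Units.mul_inv]
  have hent : Function.Injective ent := by
    rintro (⟨u, b, c⟩ | ⟨u, d⟩) (⟨u', b', c'⟩ | ⟨u', d'⟩) h <;>
      simp only [ent, Prod.mk.injEq] at h
    · obtain ⟨hu, hb, hc, -⟩ := h
      rw [Units.ext hu, hb, hc]
    · exact absurd h.1 u.ne_zero
    · exact absurd h.1.symm u'.ne_zero
    · obtain ⟨-, hu, -, hd⟩ := h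
      rw [Units.ext hu, hd]
  choose σ hσ using fun i => hgal (ent i).1 (ent i).2.1 (ent i).2.2.1 (ent i).2.2.2 (hdet i)
  -- restrictions to `K` are pairwise distinct
  let f : ι → (K →ₐ[F] Fbar) := fun i => (σ i : Fbar →ₐ[F] Fbar).comp (IsScalarTower.toAlgHom F K Fbar)
  have hf : Function.Injective f := by
    intro i j hij
    have hK : ∀ z : K, σ i (algebraMap K Fbar z) = σ j (algebraMap K Fbar z) := fun z => by
      have := AlgHom.congr_fun hij z
      simpa [f] using this
    have hPij := D.galoisAct_eq_of_forall_algebraMap_eq hK hP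
    have hQij := D.galoisAct_eq_of_forall_algebraMap_eq hK hQ
    rw [(hσ i).1, (hσ j).1] at hPij
    rw [(hσ i).2, (hσ j).2] at hQij
    obtain ⟨ha, hc⟩ := hrec _ _ _ _ hPij
    obtain ⟨hb, hd⟩ := hrec _ _ _ _ hQij
    exact hent (Prod.ext ha (Prod.ext hb (Prod.ext hc hd)))
  have hcard := Fintype.card_le_of_injective f hf
  rw [AlgHom.card F K Fbar] at hcard
  have hι : Fintype.card ι = (l - 1) * l * l + (l - 1) * l := by
    simp only [ι, Fintype.card_sum, Fintype.card_prod, ZMod.card_units l, ZMod.card]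
    ring
  calc (l - 1) * l * (l + 1) = (l - 1) * l * l + (l - 1) * l := by ring
    _ = Fintype.card ι := hι.symm
    _ ≤ Module.finrank F K := hcard

/-- **`(l−1)·l·(l+1) ≤ [K : ℚ]`** (`[K:ℚ] = [F:ℚ]·[K:F]`). [claim: Mochizuki2012, status: disputed]
[cite: Mochizuki2012, IUTchI Def. 3.1 (c) p. 62] -/
theorem sl2_card_le_finrank_rat : (l - 1) * l * (l + 1) ≤ Module.finrank ℚ K := by
  haveI : FiniteDimensional F K := Module.Finite.of_restrictScalars_finite ℚ F K
  have h := D.sl2_card_le_finrank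
  have htower : Module.finrank ℚ F * Module.finrank F K = Module.finrank ℚ K := Module.finrank_mul_finrank ℚ F K
  have hF : 1 ≤ Module.finrank ℚ F := Module.finrank_pos
  calc (l - 1) * l * (l + 1) ≤ Module.finrank F K := h
    _ ≤ Module.finrank ℚ F * Module.finrank F K := Nat.le_mul_of_pos_left _ hF
    _ = Module.finrank ℚ K := htower

/-- **`l ≥ 19 ⇒ 6840 ≤ [K : ℚ]`** (`6840 = 18·19·20 = |SL₂(𝔽_19)|`): Dupuy–Hilado's floor "Since `D, d ≥
SL₂(𝔽_l) ≥ 6840`" (arXiv:2004.13108v2, Thm 7.13.1 proof, p.29 l.27) at an initial Θ-datum, which presumes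
`l ≥ 19`. [cite: DupuyHilado2020, Thm 7.13.1 proof p.29 l.27] [cite: Mochizuki2012, IUTchI Def. 3.1 (c) p. 62] -/
theorem le_finrank_rat_of_nineteen_le (hl : 19 ≤ l) : 6840 ≤ Module.finrank ℚ K := by
  have h := D.sl2_card_le_finrank_rat
  have h18 : 18 ≤ l - 1 := by omega
  have hmono : 18 * 19 * 20 ≤ (l - 1) * l * (l + 1) :=
    Nat.mul_le_mul (Nat.mul_le_mul h18 hl) (by omega)
  omega

end InitialThetaData

end Global

end Literature.IUT.HodgeTheaters

end
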